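/-
Copyright (c) 2026 the pub-hodgecm-mathlib formalisation cell (harness21).  Prover seat hodgecm-mathlib-K2E1-p12 (g7), Track B ∕ R90-TF, h413 = `stmt-HodgeConjecture-24833`,
R90-TF section S8 «ContSpec-n½», socket (E) :276, E1-PLANCHEREL BODY — the `hadj` letter of the INTERTWINING EXPORTS ROW (S8 dealer R90-CS-plan (g4) S8-R305 (1)): the adjoint
symmetry `⟪x, M(z)y⟫ = ⟪M(z̄)x, y⟫` PROPAGATED from the Godement half-plane (where ★ `K2E1IntertwiningAdjoint` proves it for the intertwining integral) to every `z` off the candidate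
set and its conjugate, by Schwarz reflection and the identity theorem on the complement of a countable closed set.  Pure complex analysis, on letters.
-/
import Summits.HodgeConjecture.HodgeConjecture.Theorems.K2E1OperatorUnitaryAxisOfFEAxisGeneric   -- ★ exports row (this seat): the consumer of `hadj`; brings the analysis imports (incl. Mathlib `Deriv.Star`)
import Summits.HodgeConjecture.HodgeConjecture.Theorems.K2E1ConvexDiffCountableConnected         -- ★ (K2E1 lineage): `countable_of_codiscrete`, `isPreconnected_convex_diff_of_countable`; brings ★ Lit `one_lt_rank_real_complex`
import Mathlib.Analysis.Complex.CauchyIntegral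
import HarnessLib

/-!
# `hadj` CONTINUATION — `K2E1AdjointSymmetryContinuation`: the adjoint symmetry of the continued intertwining operator off the candidate set from its Godement-range form
# (Schwarz reflection + identity theorem on `ℂ ∖ (P ∪ P̄)`; pure complex analysis, on letters)

Track B ∕ R90-TF, crux h413 = `stmt-HodgeConjecture-24833`, route of record `HCCMUnconditional`; cell `hodgecm-mathlib`, R90-TF programme, section S8 «ContSpec-n½», socket (E)
(B ED. 7 :276): the E1-PLANCHEREL BODY at the τ-cut block; PB-2 chain ★ + exports row ★∕📤 (`K2E1OperatorUnitaryAxisOfFEAxisGeneric.hc1_hcs_hMc_of_fe_of_adj`, letters `hFE`, `hadj`).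
THEOREMS ONLY (no `def`, no `instance`, no `notation`, no named-fact hypothesis, no `sorry`; default heartbeats); lane `--supports stmt-HodgeConjecture-24833 --as helper` (count-neutral).
No automorphic object.  CLOSES NO SOCKET.

THE MATHEMATICS ([MoeglinWaldspurger1995, II.1.8, IV.1.9 (e), IV.1.10]; [Garrett2018, §1.10]; [Titchmarsh1939, §4.5]).  In the GODEMENT HALF-PLANE `{σ₀ < Re z}` (`σ₀ = 2` for `U(2,1)`) the
intertwining integral satisfies the adjunction `⟨M(w₀, z)h, f⟩ = ⟨h, M(w₀⁻¹, z̄)f⟩` (★ `K2E1IntertwiningAdjoint.integral_wt_smul_intertwining_mul_conj_eq_of`, `B(F)♯`-weight currency; in rank one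
`w₀⁻¹ ≡ w₀` modulo the torus), i.e. for the matrix coefficients on a block **(hGod)** `⟪x, M(z)y⟫ = ⟪M(z̄)x, y⟫` for `σ₀ < Re z`.  Both sides are holomorphic in `z` off the poles: `z ↦ ⟪x, M(z)y⟫`
on `Pᶜ` (★ exports: analytic off the closed co-discrete candidate set `P ⊆ {Re ≤ σ₀}`), and `z ↦ ⟪M(z̄)x, y⟫ = conj ⟪y, M(z̄)x⟫` on `(P̄)ᶜ` by SCHWARZ REFLECTION (Mathlib
`differentiableAt_conj_conj_iff`).  The set `U = ℂ ∖ (P ∪ P̄)` is open and PRECONNECTED (`P` is countable, ★ `countable_of_codiscrete`; a convex open set minus a countable set is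
preconnected in real rank `> 1`, ★ `isPreconnected_convex_diff_of_countable` ∘ ★ Lit `one_lt_rank_real_complex`) and contains the half-plane, so the IDENTITY THEOREM (Mathlib
`AnalyticOnNhd.eqOn_of_preconnected_of_eventuallyEq`, base point `σ₀ + 1`) propagates (hGod) to all of `U`: **`hadj_of_halfPlane`** — `⟪x, M(z)y⟫ = ⟪M(z̄)x, y⟫` whenever `z ∉ P` and
`z̄ ∉ P`, EXACTLY the `hadj` binder of ★ `hc1_hcs_hMc_of_fe_of_adj` ∕ `hc1_hcs_of_fe_of_adj_axis`.  AFTER THIS FILE `hadj` owes only its Godement-range form (hGod) — the `K_U`-matrix-coefficient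
reading of ★ `K2E1IntertwiningAdjoint` on the block (adelic S–M glue, named).
* §1 `differentiableOn_inner_map_conj` (Schwarz reflection of a matrix coefficient), `isOpen_offCandidates`, `isPreconnected_offCandidates`.
* §2 HEAD **`hadj_of_halfPlane`**.
HONEST LABEL: HC_CM is proved only modulo the 7 printed citations (2 remaining named inputs: hLiu418 = `stmt-HodgeConjecture-24832`, h413 = `stmt-HodgeConjecture-24833`) until rung 0
closes; this file asserts no named fact, closes no socket; count-neutral; (hGod) and the exports' clauses are HYPOTHESES.

## References
* [MoeglinWaldspurger1995] C. Mœglin, J.-L. Waldspurger, *Spectral decomposition and Eisenstein series* (1995), II.1.8, IV.1.9 (e), IV.1.10.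
* [Garrett2018] P. Garrett, *Modern Analysis of Automorphic Forms by Example* (2018), §1.10.
* [Titchmarsh1939] E. C. Titchmarsh, *The Theory of Functions* (2nd ed., 1939), §4.5 (reflection principle), §3.3 (identity theorem).
-/

set_option autoImplicit false
set_option linter.dupNamespace false  -- the mandated namespace repeats the summit's segment (`HodgeConjecture.HodgeConjecture`)

noncomputable section

open Set Filter Topology Complex
open scoped ComplexConjugate InnerProductSpace
open Summit.HodgeConjecture.HodgeConjecture.Cruxes.H413.K2E1ConvexDiffCountableConnected (countable_of_codiscrete isPreconnected_convex_diff_of_countable)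
open Literature.Topology.Euclidean (one_lt_rank_real_complex)

namespace Summit.HodgeConjecture.HodgeConjecture.Cruxes.H413.K2E1AdjointSymmetryContinuation

variable {V : Type*} [NormedAddCommGroup V] [InnerProductSpace ℂ V]

/-! ## §1 Schwarz reflection of a matrix coefficient; the domain `ℂ ∖ (P ∪ P̄)` -/

/-- **SCHWARZ REFLECTION OF A MATRIX COEFFICIENT**: if `z ↦ ⟪y, M(z)x⟫` is holomorphic on `Pᶜ` (open), then `z ↦ ⟪M(z̄)x, y⟫ = conj ⟪y, M(z̄)x⟫` is holomorphic on `{z | z̄ ∉ P}`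
(Mathlib `differentiableAt_conj_conj_iff`). [cite: Titchmarsh1939, §4.5] -/
theorem differentiableOn_inner_map_conj (M : ℂ → V → V) {P : Set ℂ} (hPc : IsClosed P) (x y : V) (hhol : DifferentiableOn ℂ (fun z : ℂ => ⟪y, M z x⟫_ℂ) Pᶜ) :
    DifferentiableOn ℂ (fun z : ℂ => ⟪M (conj z) x, y⟫_ℂ) {z : ℂ | conj z ∉ P} := by
  intro z hz
  have hd : DifferentiableAt ℂ (fun w : ℂ => ⟪y, M w x⟫_ℂ) (conj z) := hhol.differentiableAt (hPc.isOpen_compl.mem_nhds hz)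
  have h := (differentiableAt_conj_conj_iff (f := fun w : ℂ => ⟪y, M w x⟫_ℂ) (x := z)).2 hd
  refine (h.congr_of_eventuallyEq (Eventually.of_forall fun w => ?_)).differentiableWithinAt
  simp only [Function.comp_apply, inner_conj_symm]

/-- `{z | z ∉ P ∧ z̄ ∉ P}` is open for `P` closed. [folklore] -/
theorem isOpen_offCandidates {P : Set ℂ} (hPc : IsClosed P) : IsOpen {z : ℂ | z ∉ P ∧ conj z ∉ P} :=
  (hPc.isOpen_compl).inter ((hPc.preimage continuous_conj).isOpen_compl)

/-- **`{z | z ∉ P ∧ z̄ ∉ P}` IS PRECONNECTED** for `P` co-discrete: it is `ℂ` minus the countable set `P ∪ conj⁻¹ P` (★ `countable_of_codiscrete`, ★ `isPreconnected_convex_diff_of_countable`,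
★ Lit `one_lt_rank_real_complex`). [folklore] -/
theorem isPreconnected_offCandidates {P : Set ℂ} (hPd : ∀ z₀ : ℂ, ∀ᶠ s in 𝓝[≠] z₀, s ∉ P) : IsPreconnected {z : ℂ | z ∉ P ∧ conj z ∉ P} := by
  have hcount : (P ∪ (conj ⁻¹' P : Set ℂ)).Countable :=
    (countable_of_codiscrete hPd).union ((countable_of_codiscrete hPd).preimage (RingHom.injective _))
  have h := isPreconnected_convex_diff_of_countable one_lt_rank_real_complex convex_univ isOpen_univ hcount
  have e : (univ : Set ℂ) \ (P ∪ (conj ⁻¹' P : Set ℂ)) = {z : ℂ | z ∉ P ∧ conj z ∉ P} := by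
    ext z
    simp only [Set.mem_sdiff, mem_univ, mem_union, mem_preimage, true_and, not_or, mem_setOf_eq]
  rwa [e] at h

/-! ## §2 HEAD: `hadj` off the candidate set from its Godement-range form -/

/-- **HEAD — THE ADJOINT SYMMETRY OFF THE CANDIDATE SET FROM THE GODEMENT HALF-PLANE.**  Data: `M : ℂ → V → V` (the continued operator on a block, matrix coefficients in the `K_U`-pairing);
a closed co-discrete candidate set `P ⊆ {Re ≤ σ₀}` off which every matrix coefficient `z ↦ ⟪x, M(z)y⟫` is holomorphic (★ exports); and the GODEMENT-RANGE ADJUNCTION **(hGod)**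
`⟪x, M(z)y⟫ = ⟪M(z̄)x, y⟫` for `σ₀ < Re z` (★ `K2E1IntertwiningAdjoint` read on the block).  CONCLUSION: **`⟪x, M(z)y⟫ = ⟪M(z̄)x, y⟫` for every `z` with `z ∉ P`, `z̄ ∉ P`** — the `hadj`
binder of ★ `K2E1OperatorUnitaryAxisOfFEAxisGeneric.hc1_hcs_hMc_of_fe_of_adj` VERBATIM (Schwarz reflection §1 + identity theorem on the preconnected open `ℂ ∖ (P ∪ P̄)` from the base
point `σ₀ + 1`). [cite: MoeglinWaldspurger1995, IV.1.9, IV.1.10] [cite: Titchmarsh1939, §4.5] -/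
theorem hadj_of_halfPlane (M : ℂ → V → V) {P : Set ℂ} (hPc : IsClosed P) (hPd : ∀ z₀ : ℂ, ∀ᶠ s in 𝓝[≠] z₀, s ∉ P)
    (hhol : ∀ x y : V, DifferentiableOn ℂ (fun z : ℂ => ⟪x, M z y⟫_ℂ) Pᶜ) {σ₀ : ℝ} (hPre : ∀ z ∈ P, z.re ≤ σ₀)
    (hGod : ∀ z : ℂ, σ₀ < z.re → ∀ x y : V, ⟪x, M z y⟫_ℂ = ⟪M (conj z) x, y⟫_ℂ) :
    ∀ z : ℂ, z ∉ P → conj z ∉ P → ∀ x y : V, ⟪x, M z y⟫_ℂ = ⟪M (conj z) x, y⟫_ℂ := by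
  intro z hz hzc x y
  set U : Set ℂ := {z : ℂ | z ∉ P ∧ conj z ∉ P} with hU
  have hUo : IsOpen U := isOpen_offCandidates hPc
  -- both sides are analytic on `U`
  have hf : AnalyticOnNhd ℂ (fun z : ℂ => ⟪x, M z y⟫_ℂ) U :=
    ((hhol x y).mono fun w hw => hw.1).analyticOnNhd hUo
  have hg : AnalyticOnNhd ℂ (fun z : ℂ => ⟪M (conj z) x, y⟫_ℂ) U :=
    ((differentiableOn_inner_map_conj M hPc x y (hhol y x)).mono fun w hw => hw.2).analyticOnNhd hUo
  -- the base point `σ₀ + 1` and the half-plane neighbourhood where (hGod) holds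
  have hnotP : ∀ w : ℂ, σ₀ < w.re → w ∉ P := fun w hw hwP => absurd (hPre w hwP) (not_le.2 hw)
  have h0U : ((σ₀ + 1 : ℝ) : ℂ) ∈ U := by
    refine ⟨hnotP _ (by simp), hnotP _ ?_⟩
    rw [conj_ofReal, ofReal_re]; linarith
  have hev : (fun z : ℂ => ⟪x, M z y⟫_ℂ) =ᶠ[𝓝 (((σ₀ + 1 : ℝ) : ℂ))] fun z : ℂ => ⟪M (conj z) x, y⟫_ℂ := by
    have hopen : IsOpen {w : ℂ | σ₀ < w.re} := isOpen_lt continuous_const continuous_re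
    filter_upwards [hopen.mem_nhds (show σ₀ < (((σ₀ + 1 : ℝ) : ℂ)).re by simp)] with w hw
    exact hGod w hw x y
  exact hf.eqOn_of_preconnected_of_eventuallyEq hg (isPreconnected_offCandidates hPd) h0U hev ⟨hz, hzc⟩

end Summit.HodgeConjecture.HodgeConjecture.Cruxes.H413.K2E1AdjointSymmetryContinuation

end
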